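import Literature.Topology.PlaneTopology.ArcLoops
import HarnessLib

/-!
# Cutting a plane annulus along two rays: the two faces as Jordan domains

Topic: Topology / PlaneTopology. The combinatorial-topological core of the classical proof of
the **two-dimensional annulus theorem** from the Schoenflies theorem (E. E. Moise, *Geometric
topology in dimensions 2 and 3* (1977), Ch. 2–4; M. H. A. Newman, *Elements of the topology of
plane sets of points* (1939), Ch. V §11, θ-curves and cross-cuts): a bounded open set `E`
containing the closed unit disc, whose frontier is a Jordan curve, is cut along the two radial
segments `[1, r₁]`, `[-r₂, -1]` joining the unit circle to the first frontier points on the real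
axis. With the upper unit semicircle these segments form a cross-cut `P` of `E`; Newman's
cross-cut theorem (`Newman1939_crosscut_holds`, in the tree) splits `E ∖ P` into two domains
`Vu`, `Vl`, the second containing the unit disc, with frontiers `P ∪ κu`, `P ∪ κl` for the two
frontier arcs `κu`, `κl` of `E` between `r₁` and `-r₂`. This file takes that output as data
(`CutData`) and proves:

* `CutData.upperFace` — `Vu` is a Jordan domain whose boundary loop runs through
  `[r₁ → 1]`, the upper unit semicircle, `[-1 → -r₂]` and `κu` on the four quarters of `[0, 1]`
  (`quadLoop`, with junction values and quarter images);
* `CutData.lowerFace` — applying Newman's theorem once more, inside the Jordan domain `Vl`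
  (`CutData.lowerBig`) with the lower unit semicircle as cross-cut, splits `Vl` into the open
  unit disc and a Jordan domain `Wl` with boundary loop `[r₁ → 1]`, lower semicircle,
  `[-1 → -r₂]`, `κl`;
* the **partition** `E ∖ (𝔻̄ ∪ [1, r₁] ∪ [-r₂, -1]) = Vu ⊔ Wl` (`diff_eq_Vu_union_Wl`), the cover
  `ℂ = 𝔻̄ ∪ closure Vu ∪ closure Wl ∪ Eᶜ` and the six pairwise intersections of these four closed
  pieces (`closure_Vu_inter_closedBall = upper semicircle`, `closure_Vu_inter_closure_Wl = rays`,
  `closure_Vu_inter_compl = κu`, …) — exactly what is needed to paste four homeomorphisms into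
  one (`AnnulusTheorem.lean`);
* generic plumbing: loops through four parametrised arcs with parameter control (`quadLoop`,
  on top of `concatPath` of `ArcLoops.lean`), and the **transfer map** between two Jordan loops
  (`loopTransfer γ γ' : γ t ↦ γ' t`, continuous on `range γ` and bijective onto `range γ'`),
  used to prescribe boundary correspondences arc by arc.

Everything is proved; no named facts. Mathlib has none of this (no Jordan curve theorem).

## References

* M. H. A. Newman, *Elements of the topology of plane sets of points*, CUP (1939), Ch. V §11,
  Thms. 11·7–11·8. [Newman1939]
* E. E. Moise, *Geometric topology in dimensions 2 and 3*, GTM 47, Springer (1977), Ch. 2–4.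
-/

noncomputable section

namespace Literature.Topology.PlaneTopology

open Set Metric Real Filter _root_.Topology Bornology
open Literature.Probability.RandomPlanarGeometry (JordanDomain)
open Literature.Probability.RandomPlanarGeometry.JordanDomain

/-! ### Loops through four parametrised arcs -/

section QuadLoop

variable {γ₀ γ₁ γ₂ γ₃ : ℝ → ℂ}

/-- The loop through four parametrised arcs `γ₀, γ₁, γ₂, γ₃` (each run through at quadruple
speed on a quarter of `[0, 1]`), periodised. [folklore] -/
def quadLoop (γ₀ γ₁ γ₂ γ₃ : ℝ → ℂ) : ℝ → ℂ :=
  concatPath (concatPath γ₀ γ₁) (concatPath γ₂ γ₃) ∘ Int.fract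

/-- Junction data of four arcs closing up: `γ₀ 1 = γ₁ 0`, …, `γ₃ 1 = γ₀ 0`. [folklore] -/
structure QuadJunction (γ₀ γ₁ γ₂ γ₃ : ℝ → ℂ) : Prop where
  j₀ : γ₀ 1 = γ₁ 0
  j₁ : γ₁ 1 = γ₂ 0
  j₂ : γ₂ 1 = γ₃ 0
  j₃ : γ₃ 1 = γ₀ 0

variable (hj : QuadJunction γ₀ γ₁ γ₂ γ₃)
include hj

/-- The un-periodised loop closes up. [folklore] -/
theorem QuadJunction.concat_zero_eq_one :
    concatPath (concatPath γ₀ γ₁) (concatPath γ₂ γ₃) 0 =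
      concatPath (concatPath γ₀ γ₁) (concatPath γ₂ γ₃) 1 := by
  rw [concatPath_zero, concatPath_one, concatPath_zero, concatPath_one, hj.j₃]

/-- On the first quarter the loop is `γ₀ (4t)`. [folklore] -/
theorem quadLoop_apply_of_mem_first {t : ℝ} (ht : t ∈ Icc (0 : ℝ) (1 / 4)) :
    quadLoop γ₀ γ₁ γ₂ γ₃ t = γ₀ (4 * t) := by
  rw [quadLoop, comp_fract_apply_of_mem_Icc hj.concat_zero_eq_one ⟨ht.1, by linarith [ht.2]⟩,
    concatPath_of_le_half (by linarith [ht.2]), concatPath_of_le_half (by linarith [ht.2])]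
  ring_nf

/-- On the second quarter the loop is `γ₁ (4t - 1)`. [folklore] -/
theorem quadLoop_apply_of_mem_second {t : ℝ} (ht : t ∈ Icc (1 / 4 : ℝ) (1 / 2)) :
    quadLoop γ₀ γ₁ γ₂ γ₃ t = γ₁ (4 * t - 1) := by
  rw [quadLoop, comp_fract_apply_of_mem_Icc hj.concat_zero_eq_one ⟨by linarith [ht.1], by linarith [ht.2]⟩,
    concatPath_of_le_half ht.2, concatPath_of_half_le hj.j₀ (by linarith [ht.1])]
  ring_nf

/-- On the third quarter the loop is `γ₂ (4t - 2)`. [folklore] -/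
theorem quadLoop_apply_of_mem_third {t : ℝ} (ht : t ∈ Icc (1 / 2 : ℝ) (3 / 4)) :
    quadLoop γ₀ γ₁ γ₂ γ₃ t = γ₂ (4 * t - 2) := by
  have hj' : concatPath γ₀ γ₁ 1 = concatPath γ₂ γ₃ 0 := by
    rw [concatPath_one, concatPath_zero, hj.j₁]
  rw [quadLoop, comp_fract_apply_of_mem_Icc hj.concat_zero_eq_one ⟨by linarith [ht.1], by linarith [ht.2]⟩,
    concatPath_of_half_le hj' ht.1, concatPath_of_le_half (by linarith [ht.2])]
  ring_nf

/-- On the fourth quarter the loop is `γ₃ (4t - 3)`. [folklore] -/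
theorem quadLoop_apply_of_mem_fourth {t : ℝ} (ht : t ∈ Icc (3 / 4 : ℝ) 1) :
    quadLoop γ₀ γ₁ γ₂ γ₃ t = γ₃ (4 * t - 3) := by
  have hj' : concatPath γ₀ γ₁ 1 = concatPath γ₂ γ₃ 0 := by
    rw [concatPath_one, concatPath_zero, hj.j₁]
  rw [quadLoop, comp_fract_apply_of_mem_Icc hj.concat_zero_eq_one ⟨by linarith [ht.1], ht.2⟩,
    concatPath_of_half_le hj' (by linarith [ht.1]), concatPath_of_half_le hj.j₂ (by linarith [ht.1])]
  ring_nf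

/-- Values at the quarter points. [folklore] -/
theorem quadLoop_zero : quadLoop γ₀ γ₁ γ₂ γ₃ 0 = γ₀ 0 := by
  rw [quadLoop_apply_of_mem_first hj (by norm_num)]; norm_num

/-- Value at `¼`. [folklore] -/
theorem quadLoop_quarter : quadLoop γ₀ γ₁ γ₂ γ₃ (1 / 4) = γ₁ 0 := by
  rw [quadLoop_apply_of_mem_second hj (by norm_num)]; norm_num

/-- Value at `½`. [folklore] -/
theorem quadLoop_half : quadLoop γ₀ γ₁ γ₂ γ₃ (1 / 2) = γ₂ 0 := by
  rw [quadLoop_apply_of_mem_third hj (by norm_num)]; norm_num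

/-- Value at `¾`. [folklore] -/
theorem quadLoop_three_quarters : quadLoop γ₀ γ₁ γ₂ γ₃ (3 / 4) = γ₃ 0 := by
  rw [quadLoop_apply_of_mem_fourth hj (by norm_num)]; norm_num

/-- Image of the first quarter. [folklore] -/
theorem image_quadLoop_first : quadLoop γ₀ γ₁ γ₂ γ₃ '' Icc 0 (1 / 4) = γ₀ '' Icc 0 1 := by
  have hj' : concatPath γ₀ γ₁ 1 = concatPath γ₂ γ₃ 0 := by
    rw [concatPath_one, concatPath_zero, hj.j₁]
  rw [quadLoop, image_comp_fract_Icc hj.concat_zero_eq_one le_rfl (by norm_num),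
    image_concatPath_Icc_of_le_half (by norm_num), image_concatPath_Icc_of_le_half (by norm_num)]
  norm_num

/-- Image of the second quarter. [folklore] -/
theorem image_quadLoop_second : quadLoop γ₀ γ₁ γ₂ γ₃ '' Icc (1 / 4) (1 / 2) = γ₁ '' Icc 0 1 := by
  rw [quadLoop, image_comp_fract_Icc hj.concat_zero_eq_one (by norm_num) (by norm_num),
    image_concatPath_Icc_of_le_half le_rfl, image_concatPath_Icc_of_half_le hj.j₀ (by norm_num)]
  norm_num

/-- Image of the third quarter. [folklore] -/
theorem image_quadLoop_third : quadLoop γ₀ γ₁ γ₂ γ₃ '' Icc (1 / 2) (3 / 4) = γ₂ '' Icc 0 1 := by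
  have hj' : concatPath γ₀ γ₁ 1 = concatPath γ₂ γ₃ 0 := by
    rw [concatPath_one, concatPath_zero, hj.j₁]
  rw [quadLoop, image_comp_fract_Icc hj.concat_zero_eq_one (by norm_num) (by norm_num),
    image_concatPath_Icc_of_half_le hj' le_rfl, image_concatPath_Icc_of_le_half (by norm_num)]
  norm_num

/-- Image of the fourth quarter. [folklore] -/
theorem image_quadLoop_fourth : quadLoop γ₀ γ₁ γ₂ γ₃ '' Icc (3 / 4) 1 = γ₃ '' Icc 0 1 := by
  have hj' : concatPath γ₀ γ₁ 1 = concatPath γ₂ γ₃ 0 := by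
    rw [concatPath_one, concatPath_zero, hj.j₁]
  rw [quadLoop, image_comp_fract_Icc hj.concat_zero_eq_one (by norm_num) le_rfl,
    image_concatPath_Icc_of_half_le hj' (by norm_num), image_concatPath_Icc_of_half_le hj.j₂ (by norm_num)]
  norm_num

/-- The loop is continuous when the arcs are. [folklore] -/
theorem continuous_quadLoop (h₀ : Continuous γ₀) (h₁ : Continuous γ₁) (h₂ : Continuous γ₂)
    (h₃ : Continuous γ₃) : Continuous (quadLoop γ₀ γ₁ γ₂ γ₃) := by
  have hj' : concatPath γ₀ γ₁ 1 = concatPath γ₂ γ₃ 0 := by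
    rw [concatPath_one, concatPath_zero, hj.j₁]
  exact (continuous_concatPath (continuous_concatPath h₀ h₁ hj.j₀)
    (continuous_concatPath h₂ h₃ hj.j₂) hj').continuousOn.comp_fract'' hj.concat_zero_eq_one

omit hj in
/-- The loop is `1`-periodic. [folklore] -/
theorem periodic_quadLoop : Function.Periodic (quadLoop γ₀ γ₁ γ₂ γ₃) 1 := periodic_comp_fract

/-- The range of the loop is the union of the four traces. [folklore] -/
theorem range_quadLoop : range (quadLoop γ₀ γ₁ γ₂ γ₃) =
    γ₀ '' Icc 0 1 ∪ γ₁ '' Icc 0 1 ∪ γ₂ '' Icc 0 1 ∪ γ₃ '' Icc 0 1 := by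
  have hj' : concatPath γ₀ γ₁ 1 = concatPath γ₂ γ₃ 0 := by
    rw [concatPath_one, concatPath_zero, hj.j₁]
  rw [quadLoop, range_comp_fract hj.concat_zero_eq_one, image_concatPath_Icc_zero_one hj',
    image_concatPath_Icc_zero_one hj.j₀, image_concatPath_Icc_zero_one hj.j₂, union_assoc,
    union_assoc, union_assoc]

/-- **Injectivity of the loop on `[0, 1)`**: the four arcs are injective on `[0, 1]`,
consecutive traces meet only at the junction point, opposite traces are disjoint. [folklore] -/
theorem injOn_quadLoop (hi₀ : InjOn γ₀ (Icc 0 1)) (hi₁ : InjOn γ₁ (Icc 0 1))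
    (hi₂ : InjOn γ₂ (Icc 0 1)) (hi₃ : InjOn γ₃ (Icc 0 1))
    (h01 : γ₀ '' Icc 0 1 ∩ γ₁ '' Icc 0 1 ⊆ {γ₁ 0}) (h12 : γ₁ '' Icc 0 1 ∩ γ₂ '' Icc 0 1 ⊆ {γ₂ 0})
    (h23 : γ₂ '' Icc 0 1 ∩ γ₃ '' Icc 0 1 ⊆ {γ₃ 0}) (h30 : γ₃ '' Icc 0 1 ∩ γ₀ '' Icc 0 1 ⊆ {γ₀ 0})
    (h02 : Disjoint (γ₀ '' Icc 0 1) (γ₂ '' Icc 0 1)) (h13 : Disjoint (γ₁ '' Icc 0 1) (γ₃ '' Icc 0 1)) :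
    InjOn (quadLoop γ₀ γ₁ γ₂ γ₃) (Ico 0 1) := by
  have hj' : concatPath γ₀ γ₁ 1 = concatPath γ₂ γ₃ 0 := by
    rw [concatPath_one, concatPath_zero, hj.j₁]
  refine injOn_comp_fract (injOn_concatPath_Ico ?_ ?_ hj' ?_ ?_)
  · exact injOn_concatPath_Icc hi₀ hi₁ hj.j₀ (hj.j₀ ▸ h01)
  · exact injOn_concatPath_Icc hi₂ hi₃ hj.j₂ (hj.j₂ ▸ h23)
  · rw [concatPath_one, concatPath_zero, hj.j₃]
  · rw [image_concatPath_Icc_zero_one hj.j₀, image_concatPath_Icc_zero_one hj.j₂, concatPath_one,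
      concatPath_zero, hj.j₁]
    rintro z ⟨hz₁ | hz₁, hz₂ | hz₂⟩
    · exact absurd hz₂ (Set.disjoint_left.1 h02 hz₁)
    · exact Or.inr (h30 ⟨hz₂, hz₁⟩)
    · exact Or.inl (h12 ⟨hz₁, hz₂⟩)
    · exact absurd hz₂ (Set.disjoint_left.1 h13 hz₁)

end QuadLoop

/-! ### Transferring one loop parametrisation to another -/

section Transfer

variable {γ γ' : ℝ → ℂ}

/-- The map of `range γ` onto `range γ'` sending `γ t ↦ γ' t` (defined everywhere through a
right inverse of `γ` on `[0, 1)`). [folklore] -/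
def loopTransfer (γ γ' : ℝ → ℂ) : ℂ → ℂ := γ' ∘ Function.invFunOn γ (Ico 0 1)

/-- **`loopTransfer γ γ' (γ t) = γ' t`** for `1`-periodic loops with `γ` injective on a period.
[folklore] -/
theorem loopTransfer_apply (hp : Function.Periodic γ 1) (hinj : InjOn γ (Ico 0 1))
    (hp' : Function.Periodic γ' 1) (t : ℝ) : loopTransfer γ γ' (γ t) = γ' t := by
  have hft : Int.fract t ∈ Ico (0 : ℝ) 1 := ⟨Int.fract_nonneg t, Int.fract_lt_one t⟩
  have hγf : γ (Int.fract t) = γ t := by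
    rw [Int.fract, show t - ⌊t⌋ = t - (⌊t⌋ : ℤ) • (1 : ℝ) by simp]
    exact hp.sub_zsmul_eq ⌊t⌋
  have hγ'f : γ' (Int.fract t) = γ' t := by
    rw [Int.fract, show t - ⌊t⌋ = t - (⌊t⌋ : ℤ) • (1 : ℝ) by simp]
    exact hp'.sub_zsmul_eq ⌊t⌋
  have hmem : γ t ∈ γ '' Ico 0 1 := ⟨Int.fract t, hft, hγf⟩
  have h1 : Function.invFunOn γ (Ico 0 1) (γ t) ∈ Ico (0 : ℝ) 1 := Function.invFunOn_mem hmem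
  have h2 : γ (Function.invFunOn γ (Ico 0 1) (γ t)) = γ t := Function.invFunOn_eq hmem
  have h3 : Function.invFunOn γ (Ico 0 1) (γ t) = Int.fract t :=
    hinj h1 hft (h2.trans hγf.symm)
  simp only [loopTransfer, Function.comp_apply, h3, hγ'f]

/-- The range of a `1`-periodic loop is the image of `[0, 1]`. [folklore] -/
theorem range_eq_image_Icc_of_periodic (hp : Function.Periodic γ 1) : range γ = γ '' Icc 0 1 := by
  refine Subset.antisymm ?_ (image_subset_range _ _)
  rintro _ ⟨t, rfl⟩
  refine ⟨Int.fract t, ⟨Int.fract_nonneg t, (Int.fract_lt_one t).le⟩, ?_⟩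
  rw [Int.fract, show t - ⌊t⌋ = t - (⌊t⌋ : ℤ) • (1 : ℝ) by simp]
  exact hp.sub_zsmul_eq ⌊t⌋

/-- **Continuity of the transfer map on `range γ`** (for `γ`, `γ'` continuous and periodic,
`γ` injective on a period): pre-images of closed sets are images of compact parameter sets.
[folklore] -/
theorem continuousOn_loopTransfer (hc : Continuous γ) (hp : Function.Periodic γ 1)
    (hinj : InjOn γ (Ico 0 1)) (hc' : Continuous γ') (hp' : Function.Periodic γ' 1) :
    ContinuousOn (loopTransfer γ γ') (range γ) := by
  rw [continuousOn_iff_isClosed]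
  intro C hC
  refine ⟨γ '' (γ' ⁻¹' C ∩ Icc 0 1), ?_, ?_⟩
  · exact ((isCompact_Icc.inter_left (hC.preimage hc')).image hc).isClosed
  · ext z
    constructor
    · rintro ⟨hz, w, rfl⟩
      refine ⟨⟨Int.fract w, ⟨?_, Int.fract_nonneg w, (Int.fract_lt_one w).le⟩, ?_⟩, w, rfl⟩
      · show γ' (Int.fract w) ∈ C
        have e : γ' (Int.fract w) = γ' w := by
          rw [Int.fract, show w - ⌊w⌋ = w - (⌊w⌋ : ℤ) • (1 : ℝ) by simp]
          exact hp'.sub_zsmul_eq ⌊w⌋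
        rw [e, ← loopTransfer_apply hp hinj hp' w]
        exact hz
      · rw [Int.fract, show w - ⌊w⌋ = w - (⌊w⌋ : ℤ) • (1 : ℝ) by simp]
        exact hp.sub_zsmul_eq ⌊w⌋
    · rintro ⟨⟨s, ⟨hsC, -⟩, rfl⟩, -⟩
      refine ⟨?_, s, rfl⟩
      show loopTransfer γ γ' (γ s) ∈ C
      rwa [loopTransfer_apply hp hinj hp']

/-- **The transfer map is a bijection of `range γ` onto `range γ'`** when `γ'` is also injective
on a period. [folklore] -/
theorem bijOn_loopTransfer (hp : Function.Periodic γ 1) (hinj : InjOn γ (Ico 0 1))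
    (hp' : Function.Periodic γ' 1) (hinj' : InjOn γ' (Ico 0 1)) :
    BijOn (loopTransfer γ γ') (range γ) (range γ') := by
  refine ⟨?_, ?_, ?_⟩
  · rintro _ ⟨t, rfl⟩
    rw [loopTransfer_apply hp hinj hp']
    exact mem_range_self t
  · rintro _ ⟨s, rfl⟩ _ ⟨t, rfl⟩ h
    rw [loopTransfer_apply hp hinj hp', loopTransfer_apply hp hinj hp'] at h
    -- reduce to one period
    have hs : γ' (Int.fract s) = γ' s := by
      rw [Int.fract, show s - ⌊s⌋ = s - (⌊s⌋ : ℤ) • (1 : ℝ) by simp]; exact hp'.sub_zsmul_eq ⌊s⌋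
    have ht : γ' (Int.fract t) = γ' t := by
      rw [Int.fract, show t - ⌊t⌋ = t - (⌊t⌋ : ℤ) • (1 : ℝ) by simp]; exact hp'.sub_zsmul_eq ⌊t⌋
    have hst : Int.fract s = Int.fract t :=
      hinj' ⟨Int.fract_nonneg s, Int.fract_lt_one s⟩ ⟨Int.fract_nonneg t, Int.fract_lt_one t⟩
        (by rw [hs, ht, h])
    have hs' : γ (Int.fract s) = γ s := by
      rw [Int.fract, show s - ⌊s⌋ = s - (⌊s⌋ : ℤ) • (1 : ℝ) by simp]; exact hp.sub_zsmul_eq ⌊s⌋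
    have ht' : γ (Int.fract t) = γ t := by
      rw [Int.fract, show t - ⌊t⌋ = t - (⌊t⌋ : ℤ) • (1 : ℝ) by simp]; exact hp.sub_zsmul_eq ⌊t⌋
    rw [← hs', ← ht', hst]
  · rintro _ ⟨t, rfl⟩
    exact ⟨γ t, mem_range_self t, loopTransfer_apply hp hinj hp' t⟩

/-- The transfer map sends `range γ` into `range γ'`. [folklore] -/
theorem loopTransfer_mem_range (hp : Function.Periodic γ 1) (hinj : InjOn γ (Ico 0 1))
    (hp' : Function.Periodic γ' 1) {z : ℂ} (hz : z ∈ range γ) : loopTransfer γ γ' z ∈ range γ' := by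
  obtain ⟨t, rfl⟩ := hz
  rw [loopTransfer_apply hp hinj hp']
  exact mem_range_self t

end Transfer

end Literature.Topology.PlaneTopology

end

noncomputable section

namespace Literature.Topology.PlaneTopology

open Set Metric Real Filter _root_.Topology Bornology
open Literature.Probability.RandomPlanarGeometry (JordanDomain)
open Literature.Probability.RandomPlanarGeometry.JordanDomain

/-! ### The standard arcs: radial segments and unit semicircles -/

section Arcs

/-- The radial segment on the positive real axis from `r` (at `u = 0`) to `1` (at `u = 1`).
[folklore] -/
def rayPos (r : ℝ) (u : ℝ) : ℂ := ((r + u * (1 - r) : ℝ) : ℂ)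

/-- The radial segment on the negative real axis from `-1` (at `u = 0`) to `-r` (at `u = 1`).
[folklore] -/
def rayNeg (r : ℝ) (u : ℝ) : ℂ := ((-(1 + u * (r - 1)) : ℝ) : ℂ)

/-- The upper unit semicircle from `1` (at `u = 0`) to `-1` (at `u = 1`) through `i`.
[folklore] -/
def semiUp (u : ℝ) : ℂ := (disc 1 one_pos).boundary (u / 2)

/-- The lower unit semicircle from `1` (at `u = 0`) to `-1` (at `u = 1`) through `-i`.
[folklore] -/
def semiDown (u : ℝ) : ℂ := (disc 1 one_pos).boundary (-(u / 2))

variable {r : ℝ}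

/-- The right ray is continuous. [folklore] -/
@[fun_prop] theorem continuous_rayPos : Continuous (rayPos r) := by unfold rayPos; fun_prop
/-- The left ray is continuous. [folklore] -/
@[fun_prop] theorem continuous_rayNeg : Continuous (rayNeg r) := by unfold rayNeg; fun_prop
/-- The upper semicircle is continuous. [folklore] -/
@[fun_prop] theorem continuous_semiUp : Continuous semiUp :=
  (disc 1 one_pos).continuous_boundary.comp (continuous_id.div_const _)
/-- The lower semicircle is continuous. [folklore] -/
@[fun_prop] theorem continuous_semiDown : Continuous semiDown :=
  (disc 1 one_pos).continuous_boundary.comp ((continuous_id.div_const _).neg)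

/-- The right ray starts at `r`. [folklore] -/
@[simp] theorem rayPos_zero : rayPos r 0 = r := by simp [rayPos]
/-- The right ray ends at `1`. [folklore] -/
@[simp] theorem rayPos_one : rayPos r 1 = 1 := by simp [rayPos]
/-- The left ray starts at `-1`. [folklore] -/
@[simp] theorem rayNeg_zero : rayNeg r 0 = -1 := by simp [rayNeg]
/-- The left ray ends at `-r`. [folklore] -/
@[simp] theorem rayNeg_one : rayNeg r 1 = -r := by simp [rayNeg]
/-- The upper semicircle starts at `1`. [folklore] -/
@[simp] theorem semiUp_zero : semiUp 0 = 1 := by simp [semiUp]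
/-- The upper semicircle ends at `-1`. [folklore] -/
@[simp] theorem semiUp_one : semiUp 1 = -1 := by
  rw [semiUp, disc_boundary_half]; simp
/-- The lower semicircle starts at `1`. [folklore] -/
@[simp] theorem semiDown_zero : semiDown 0 = 1 := by simp [semiDown]
/-- The lower semicircle ends at `-1`. [folklore] -/
@[simp] theorem semiDown_one : semiDown 1 = -1 := by
  rw [semiDown, show -((1 : ℝ) / 2) = 1 / 2 - 1 by norm_num, (disc 1 one_pos).periodic_boundary.sub_eq,
    disc_boundary_half]; simp

/-- The trace of `rayPos r` (`r > 1`) is the real interval `[1, r]`. [folklore] -/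
theorem mem_image_rayPos_iff (hr : 1 < r) {z : ℂ} :
    z ∈ rayPos r '' Icc 0 1 ↔ ∃ x ∈ Icc 1 r, (x : ℂ) = z := by
  constructor
  · rintro ⟨u, hu, rfl⟩
    exact ⟨r + u * (1 - r), ⟨by nlinarith [hu.2], by nlinarith [hu.1]⟩, rfl⟩
  · rintro ⟨x, hx, rfl⟩
    refine ⟨(r - x) / (r - 1), ⟨div_nonneg (by linarith [hx.2]) (by linarith),
      (div_le_one (by linarith)).2 (by linarith [hx.1])⟩, ?_⟩
    have hr1 : r - 1 ≠ 0 := by linarith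
    have e : r + (r - x) / (r - 1) * (1 - r) = x := by field_simp; ring
    simp only [rayPos, e]

/-- The trace of `rayNeg r` (`r > 1`) is the real interval `[-r, -1]`. [folklore] -/
theorem mem_image_rayNeg_iff (hr : 1 < r) {z : ℂ} :
    z ∈ rayNeg r '' Icc 0 1 ↔ ∃ x ∈ Icc 1 r, (-(x : ℂ)) = z := by
  constructor
  · rintro ⟨u, hu, rfl⟩
    refine ⟨1 + u * (r - 1), ⟨by nlinarith [hu.1], by nlinarith [hu.2]⟩, ?_⟩
    simp [rayNeg]
  · rintro ⟨x, hx, rfl⟩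
    refine ⟨(x - 1) / (r - 1), ⟨div_nonneg (by linarith [hx.1]) (by linarith),
      (div_le_one (by linarith)).2 (by linarith [hx.2])⟩, ?_⟩
    have hr1 : r - 1 ≠ 0 := by linarith
    have e : 1 + (x - 1) / (r - 1) * (r - 1) = x := by field_simp; ring
    simp only [rayNeg, e]
    push_cast
    ring

/-- The right ray is injective (`r > 1`). [folklore] -/
theorem injOn_rayPos (hr : 1 < r) : InjOn (rayPos r) (Icc 0 1) := by
  intro u _ v _ h
  simp only [rayPos, Complex.ofReal_inj] at h
  have : u * (1 - r) = v * (1 - r) := by linarith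
  exact mul_right_cancel₀ (by linarith) this

/-- The left ray is injective (`r > 1`). [folklore] -/
theorem injOn_rayNeg (hr : 1 < r) : InjOn (rayNeg r) (Icc 0 1) := by
  intro u _ v _ h
  simp only [rayNeg, Complex.ofReal_inj, neg_inj] at h
  have : u * (r - 1) = v * (r - 1) := by linarith
  exact mul_right_cancel₀ (by linarith) this

/-- The upper semicircle is injective on `[0, 1]`. [folklore] -/
theorem injOn_semiUp : InjOn semiUp (Icc 0 1) := by
  intro u hu v hv h
  have := (disc 1 one_pos).injOn_boundary_Icc (s := 0) (t := 1 / 2) (by norm_num)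
    ⟨by linarith [hu.1], by linarith [hu.2]⟩ ⟨by linarith [hv.1], by linarith [hv.2]⟩ h
  linarith

/-- The lower semicircle is injective on `[0, 1]`. [folklore] -/
theorem injOn_semiDown : InjOn semiDown (Icc 0 1) := by
  intro u hu v hv h
  have := (disc 1 one_pos).injOn_boundary_Icc (s := -(1 / 2)) (t := 0) (by norm_num)
    ⟨by linarith [hu.2], by linarith [hu.1]⟩ ⟨by linarith [hv.2], by linarith [hv.1]⟩ h
  linarith

/-- The trace of `semiUp` is the closed upper unit semicircle `∂𝔻 '' [0, ½]`. [folklore] -/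
theorem image_semiUp : semiUp '' Icc 0 1 = (disc 1 one_pos).boundary '' Icc 0 (1 / 2) := by
  ext z; constructor
  · rintro ⟨u, hu, rfl⟩; exact ⟨u / 2, ⟨by linarith [hu.1], by linarith [hu.2]⟩, rfl⟩
  · rintro ⟨t, ht, rfl⟩; exact ⟨2 * t, ⟨by linarith [ht.1], by linarith [ht.2]⟩, by simp [semiUp]⟩

/-- The trace of `semiDown` is the closed lower unit semicircle `∂𝔻 '' [½, 1]`. [folklore] -/
theorem image_semiDown : semiDown '' Icc 0 1 = (disc 1 one_pos).boundary '' Icc (1 / 2) 1 := by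
  ext z; constructor
  · rintro ⟨u, hu, rfl⟩
    refine ⟨1 - u / 2, ⟨by linarith [hu.2], by linarith [hu.1]⟩, ?_⟩
    rw [semiDown, show -(u / 2) = 1 - u / 2 - 1 by ring, (disc 1 one_pos).periodic_boundary.sub_eq]
  · rintro ⟨t, ht, rfl⟩
    refine ⟨2 * (1 - t), ⟨by linarith [ht.2], by linarith [ht.1]⟩, ?_⟩
    rw [semiDown, show -(2 * (1 - t) / 2) = t - 1 by ring, (disc 1 one_pos).periodic_boundary.sub_eq]

/-- The two unit semicircles make up the unit circle. [folklore] -/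
theorem image_semiUp_union_image_semiDown : semiUp '' Icc 0 1 ∪ semiDown '' Icc 0 1 = sphere 0 1 := by
  rw [image_semiUp, image_semiDown, ← frontier_disc_carrier (hr := one_pos),
    (disc 1 one_pos).frontier_eq_union_image_boundary 0 (1 / 2)]
  norm_num

/-- The two unit semicircles meet only at `±1`. [folklore] -/
theorem image_semiUp_inter_image_semiDown :
    semiUp '' Icc 0 1 ∩ semiDown '' Icc 0 1 ⊆ {1, -1} := by
  rw [image_semiUp, image_semiDown]
  have h := (disc 1 one_pos).image_boundary_inter_subset (s := 0) (t := 1 / 2) (by norm_num) (by norm_num)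
  rw [disc_boundary_zero, disc_boundary_half] at h
  norm_num at h
  simpa using h

/-- The upper semicircle lies on the unit circle. [folklore] -/
theorem image_semiUp_subset_sphere : semiUp '' Icc 0 1 ⊆ sphere 0 1 :=
  image_semiUp_union_image_semiDown ▸ subset_union_left

/-- The lower semicircle lies on the unit circle. [folklore] -/
theorem image_semiDown_subset_sphere : semiDown '' Icc 0 1 ⊆ sphere 0 1 :=
  image_semiUp_union_image_semiDown ▸ subset_union_right

/-- Points of the upper semicircle have non-negative imaginary part. [folklore] -/
theorem im_nonneg_of_mem_image_semiUp {z : ℂ} (hz : z ∈ semiUp '' Icc 0 1) : 0 ≤ z.im :=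
  im_nonneg_of_mem_image_Icc_zero_half (image_semiUp ▸ hz)

/-- Points of the lower semicircle have non-positive imaginary part. [folklore] -/
theorem im_nonpos_of_mem_image_semiDown {z : ℂ} (hz : z ∈ semiDown '' Icc 0 1) : z.im ≤ 0 :=
  im_nonpos_of_mem_image_Icc_half_one (image_semiDown ▸ hz)

/-- Interior points of the lower semicircle have negative imaginary part. [folklore] -/
theorem im_neg_of_mem_image_semiDown_Ioo {z : ℂ} (hz : z ∈ semiDown '' Ioo 0 1) : z.im < 0 := by
  obtain ⟨u, hu, rfl⟩ := hz
  have : semiDown u ∈ (disc 1 one_pos).boundary '' Ioo (1 / 2) 1 := by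
    refine ⟨1 - u / 2, ⟨by linarith [hu.2], by linarith [hu.1]⟩, ?_⟩
    rw [semiDown, show -(u / 2) = 1 - u / 2 - 1 by ring, (disc 1 one_pos).periodic_boundary.sub_eq]
  exact im_neg_of_mem_image_Ioo_half_one this

/-- The lower semicircle minus its end-points is the image of the open parameter interval.
[folklore] -/
theorem image_semiDown_diff : semiDown '' Icc 0 1 \ {1, -1} ⊆ semiDown '' Ioo 0 1 := by
  rintro z ⟨⟨u, hu, rfl⟩, hne⟩
  refine ⟨u, ⟨hu.1.lt_of_ne ?_, hu.2.lt_of_ne ?_⟩, rfl⟩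
  · rintro rfl; exact hne (by simp)
  · rintro rfl; exact hne (by simp)

/-- A point of the trace of `rayPos r` in the closed unit disc is `1`. [folklore] -/
theorem eq_one_of_mem_image_rayPos (hr : 1 < r) {z : ℂ} (hz : z ∈ rayPos r '' Icc 0 1)
    (hz' : ‖z‖ ≤ 1) : z = 1 := by
  obtain ⟨x, hx, rfl⟩ := (mem_image_rayPos_iff hr).1 hz
  rw [Complex.norm_real, Real.norm_eq_abs, abs_of_pos (by linarith [hx.1])] at hz'
  have : x = 1 := le_antisymm hz' hx.1
  simp [this]

/-- A point of the trace of `rayNeg r` in the closed unit disc is `-1`. [folklore] -/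
theorem eq_neg_one_of_mem_image_rayNeg (hr : 1 < r) {z : ℂ} (hz : z ∈ rayNeg r '' Icc 0 1)
    (hz' : ‖z‖ ≤ 1) : z = -1 := by
  obtain ⟨x, hx, rfl⟩ := (mem_image_rayNeg_iff hr).1 hz
  rw [norm_neg, Complex.norm_real, Real.norm_eq_abs, abs_of_pos (by linarith [hx.1])] at hz'
  have : x = 1 := le_antisymm hz' hx.1
  simp [this]

/-- The two rays are disjoint. [folklore] -/
theorem disjoint_image_rayPos_image_rayNeg (hr : 1 < r) {r' : ℝ} (hr' : 1 < r') :
    Disjoint (rayPos r '' Icc 0 1) (rayNeg r' '' Icc 0 1) := by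
  rw [Set.disjoint_left]
  intro z hz hz'
  obtain ⟨x, hx, rfl⟩ := (mem_image_rayPos_iff hr).1 hz
  obtain ⟨y, hy, h⟩ := (mem_image_rayNeg_iff hr').1 hz'
  have := congrArg Complex.re h
  simp at this
  linarith [hx.1, hy.1]

/-- The positive ray meets the unit circle only at `1`. [folklore] -/
theorem image_rayPos_inter_sphere (hr : 1 < r) : rayPos r '' Icc 0 1 ∩ sphere 0 1 ⊆ {1} :=
  fun _ hz => eq_one_of_mem_image_rayPos hr hz.1 (mem_sphere_zero_iff_norm.1 hz.2).le

/-- The negative ray meets the unit circle only at `-1`. [folklore] -/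
theorem image_rayNeg_inter_sphere (hr : 1 < r) : rayNeg r '' Icc 0 1 ∩ sphere 0 1 ⊆ {-1} :=
  fun _ hz => eq_neg_one_of_mem_image_rayNeg hr hz.1 (mem_sphere_zero_iff_norm.1 hz.2).le

/-- The rays and semicircles are simple arcs. [folklore] -/
theorem isSimpleArc_rayPos (hr : 1 < r) : IsSimpleArc (rayPos r '' Icc 0 1) r 1 :=
  ⟨rayPos r, continuous_rayPos.continuousOn, injOn_rayPos hr, rfl, rayPos_zero, rayPos_one⟩

/-- The left ray is a simple arc from `-1` to `-r`. [folklore] -/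
theorem isSimpleArc_rayNeg (hr : 1 < r) : IsSimpleArc (rayNeg r '' Icc 0 1) (-1) (-r) :=
  ⟨rayNeg r, continuous_rayNeg.continuousOn, injOn_rayNeg hr, rfl, rayNeg_zero, rayNeg_one⟩

/-- The upper semicircle is a simple arc from `1` to `-1`. [folklore] -/
theorem isSimpleArc_semiUp : IsSimpleArc (semiUp '' Icc 0 1) 1 (-1) :=
  ⟨semiUp, continuous_semiUp.continuousOn, injOn_semiUp, rfl, semiUp_zero, semiUp_one⟩

/-- The lower semicircle is a simple arc from `1` to `-1`. [folklore] -/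
theorem isSimpleArc_semiDown : IsSimpleArc (semiDown '' Icc 0 1) 1 (-1) :=
  ⟨semiDown, continuous_semiDown.continuousOn, injOn_semiDown, rfl, semiDown_zero, semiDown_one⟩

end Arcs

/-! ### Cut data: a domain containing the closed unit disc, cut along the real axis -/

/-- **Cut data for an annulus.** A bounded open set `E ⊆ ℂ` containing the closed unit disc,
two radial segments `[1, r₁]` and `[-r₂, -1]` running inside `E` to frontier points `r₁`, `-r₂`,
a decomposition of `frontier E` into two simple arcs `κu`, `κl` from `-r₂` to `r₁` meeting only
at their end-points, and the two components `Vu`, `Vl` of `E` minus the cross-cut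
`P = [1, r₁] ∪ (upper unit semicircle) ∪ [-r₂, -1]` as produced by Newman's cross-cut theorem,
labelled so that `Vl` contains the open unit disc. [folklore] -/
structure CutData where
  /-- The outer open set. -/
  E : Set ℂ
  isOpen_E : IsOpen E
  isBounded_E : IsBounded E
  isConnected_E : IsConnected E
  closedBall_subset : closedBall (0 : ℂ) 1 ⊆ E
  /-- The right ray ends at `r₁ ∈ frontier E`. -/
  r₁ : ℝ
  /-- The left ray ends at `-r₂ ∈ frontier E`. -/
  r₂ : ℝ
  one_lt_r₁ : 1 < r₁
  one_lt_r₂ : 1 < r₂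
  ofReal_mem : ∀ x ∈ Ico (1 : ℝ) r₁, (x : ℂ) ∈ E
  neg_ofReal_mem : ∀ x ∈ Ico (1 : ℝ) r₂, (-(x : ℂ)) ∈ E
  /-- The frontier arc adjacent to the upper component, from `-r₂` to `r₁`. -/
  κu : ℝ → ℂ
  /-- The frontier arc adjacent to the lower component, from `-r₂` to `r₁`. -/
  κl : ℝ → ℂ
  continuous_κu : Continuous κu
  continuous_κl : Continuous κl
  injOn_κu : InjOn κu (Icc 0 1)
  injOn_κl : InjOn κl (Icc 0 1)
  κu_zero : κu 0 = -r₂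
  κu_one : κu 1 = r₁
  κl_zero : κl 0 = -r₂
  κl_one : κl 1 = r₁
  frontier_E : frontier E = κu '' Icc 0 1 ∪ κl '' Icc 0 1
  image_κu_inter_image_κl : κu '' Icc 0 1 ∩ κl '' Icc 0 1 ⊆ {(r₁ : ℂ), -(r₂ : ℂ)}
  /-- The upper component of `E ∖ P`. -/
  Vu : Set ℂ
  /-- The lower component of `E ∖ P` (the one containing the unit disc). -/
  Vl : Set ℂ
  isOpen_Vu : IsOpen Vu
  isOpen_Vl : IsOpen Vl
  isConnected_Vu : IsConnected Vu
  isConnected_Vl : IsConnected Vl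
  disjoint_Vu_Vl : Disjoint Vu Vl
  Vu_union_Vl : Vu ∪ Vl = E \ (rayPos r₁ '' Icc 0 1 ∪ semiUp '' Icc 0 1 ∪ rayNeg r₂ '' Icc 0 1)
  frontier_Vu : frontier Vu = (rayPos r₁ '' Icc 0 1 ∪ semiUp '' Icc 0 1 ∪ rayNeg r₂ '' Icc 0 1) ∪ κu '' Icc 0 1
  frontier_Vl : frontier Vl = (rayPos r₁ '' Icc 0 1 ∪ semiUp '' Icc 0 1 ∪ rayNeg r₂ '' Icc 0 1) ∪ κl '' Icc 0 1
  ball_subset_Vl : ball (0 : ℂ) 1 ⊆ Vl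

/-- The upper unit semicircle (trace of `semiUp`). [folklore] -/
def Su : Set ℂ := semiUp '' Icc 0 1

/-- The lower unit semicircle (trace of `semiDown`). [folklore] -/
def Sd : Set ℂ := semiDown '' Icc 0 1

namespace CutData

variable (c : CutData)

/-- The right ray `[1, r₁]` of the cut. [folklore] -/
def L₁ : Set ℂ := rayPos c.r₁ '' Icc 0 1
/-- The left ray `[-r₂, -1]` of the cut. [folklore] -/
def L₂ : Set ℂ := rayNeg c.r₂ '' Icc 0 1
/-- The upper frontier arc. [folklore] -/
def Ku : Set ℂ := c.κu '' Icc 0 1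
/-- The lower frontier arc. [folklore] -/
def Kl : Set ℂ := c.κl '' Icc 0 1
/-- The cross-cut `P = [1, r₁] ∪ (upper semicircle) ∪ [-r₂, -1]`. [folklore] -/
def P : Set ℂ := c.L₁ ∪ Su ∪ c.L₂

/-- The cross-cut, unfolded. [folklore] -/
theorem P_def : c.P = rayPos c.r₁ '' Icc 0 1 ∪ semiUp '' Icc 0 1 ∪ rayNeg c.r₂ '' Icc 0 1 := rfl

/-- The frontier of `E` is `κu ∪ κl` (field, in the short notation). [folklore] -/
theorem frontier_E' : frontier c.E = c.Ku ∪ c.Kl := c.frontier_E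
/-- `Vu ∪ Vl = E ∖ P` (field, in the short notation). [folklore] -/
theorem Vu_union_Vl' : c.Vu ∪ c.Vl = c.E \ c.P := c.Vu_union_Vl
/-- `frontier Vu = P ∪ κu` (field, in the short notation). [folklore] -/
theorem frontier_Vu' : frontier c.Vu = c.P ∪ c.Ku := c.frontier_Vu
/-- `frontier Vl = P ∪ κl` (field, in the short notation). [folklore] -/
theorem frontier_Vl' : frontier c.Vl = c.P ∪ c.Kl := c.frontier_Vl

/-! #### Elementary incidences -/

/-- The open set `E` misses its frontier. [folklore] -/
theorem disjoint_E_frontier : Disjoint c.E (frontier c.E) :=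
  Set.disjoint_iff_inter_eq_empty.2 c.isOpen_E.inter_frontier_eq

/-- `κu` lies on the frontier of `E`. [folklore] -/
theorem Ku_subset_frontier : c.Ku ⊆ frontier c.E := c.frontier_E' ▸ subset_union_left
/-- `κl` lies on the frontier of `E`. [folklore] -/
theorem Kl_subset_frontier : c.Kl ⊆ frontier c.E := c.frontier_E' ▸ subset_union_right

/-- Frontier points of the open set `E` are not in `E`. [folklore] -/
theorem not_mem_E_of_mem_frontier {z : ℂ} (hz : z ∈ frontier c.E) : z ∉ c.E := fun h =>
  Set.disjoint_left.1 c.disjoint_E_frontier h hz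

/-- The unit circle lies in `E`. [folklore] -/
theorem sphere_subset_E : sphere (0 : ℂ) 1 ⊆ c.E := sphere_subset_closedBall.trans c.closedBall_subset
/-- The upper semicircle lies in `E`. [folklore] -/
theorem Su_subset_E : Su ⊆ c.E := image_semiUp_subset_sphere.trans c.sphere_subset_E
/-- The lower semicircle lies in `E`. [folklore] -/
theorem Sd_subset_E : Sd ⊆ c.E := image_semiDown_subset_sphere.trans c.sphere_subset_E

/-- `r₁` is a frontier point of `E`. [folklore] -/
theorem r₁_mem_frontier : (c.r₁ : ℂ) ∈ frontier c.E := by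
  have : (c.r₁ : ℂ) ∈ c.Ku := ⟨1, ⟨zero_le_one, le_rfl⟩, c.κu_one⟩
  exact c.Ku_subset_frontier this

/-- `-r₂` is a frontier point of `E`. [folklore] -/
theorem neg_r₂_mem_frontier : (-(c.r₂ : ℂ)) ∈ frontier c.E := by
  have : (-(c.r₂ : ℂ)) ∈ c.Ku := ⟨0, ⟨le_rfl, zero_le_one⟩, c.κu_zero⟩
  exact c.Ku_subset_frontier this

/-- Points of the right ray other than `r₁` lie in `E`. [folklore] -/
theorem mem_E_of_mem_L₁ {z : ℂ} (hz : z ∈ c.L₁) (hne : z ≠ c.r₁) : z ∈ c.E := by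
  obtain ⟨x, hx, rfl⟩ := (mem_image_rayPos_iff c.one_lt_r₁).1 hz
  exact c.ofReal_mem x ⟨hx.1, hx.2.lt_of_ne fun h => hne (by subst h; rfl)⟩

/-- Points of the left ray other than `-r₂` lie in `E`. [folklore] -/
theorem mem_E_of_mem_L₂ {z : ℂ} (hz : z ∈ c.L₂) (hne : z ≠ -c.r₂) : z ∈ c.E := by
  obtain ⟨x, hx, rfl⟩ := (mem_image_rayNeg_iff c.one_lt_r₂).1 hz
  exact c.neg_ofReal_mem x ⟨hx.1, hx.2.lt_of_ne fun h => hne (by subst h; rfl)⟩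

/-- The right ray meets the frontier of `E` only at `r₁`. [folklore] -/
theorem L₁_inter_frontier : c.L₁ ∩ frontier c.E ⊆ {(c.r₁ : ℂ)} := fun z hz => by
  by_contra hne
  exact c.not_mem_E_of_mem_frontier hz.2 (c.mem_E_of_mem_L₁ hz.1 hne)

/-- The left ray meets the frontier of `E` only at `-r₂`. [folklore] -/
theorem L₂_inter_frontier : c.L₂ ∩ frontier c.E ⊆ {-(c.r₂ : ℂ)} := fun z hz => by
  by_contra hne
  exact c.not_mem_E_of_mem_frontier hz.2 (c.mem_E_of_mem_L₂ hz.1 hne)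

/-- The cross-cut meets the frontier of `E` only at `r₁`, `-r₂`. [folklore] -/
theorem P_inter_frontier : c.P ∩ frontier c.E ⊆ {(c.r₁ : ℂ), -(c.r₂ : ℂ)} := by
  rintro z ⟨(hz | hz) | hz, hzf⟩
  · exact Or.inl (c.L₁_inter_frontier ⟨hz, hzf⟩)
  · exact absurd (c.Su_subset_E hz) (c.not_mem_E_of_mem_frontier hzf)
  · exact Or.inr (c.L₂_inter_frontier ⟨hz, hzf⟩)

/-- The upper semicircle misses the frontier of `E`. [folklore] -/
theorem Su_inter_frontier : Su ∩ frontier c.E = ∅ :=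
  eq_empty_of_forall_notMem fun _ hz => c.not_mem_E_of_mem_frontier hz.2 (c.Su_subset_E hz.1)

/-- The lower semicircle misses the frontier of `E`. [folklore] -/
theorem Sd_inter_frontier : Sd ∩ frontier c.E = ∅ :=
  eq_empty_of_forall_notMem fun _ hz => c.not_mem_E_of_mem_frontier hz.2 (c.Sd_subset_E hz.1)

/-- The cross-cut lies in `E` except for its end-points `r₁`, `-r₂`. [folklore] -/
theorem P_subset_union : c.P ⊆ c.E ∪ {(c.r₁ : ℂ), -(c.r₂ : ℂ)} := by
  rintro z ((hz | hz) | hz)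
  · by_cases h : z = c.r₁
    · exact Or.inr (Or.inl h)
    · exact Or.inl (c.mem_E_of_mem_L₁ hz h)
  · exact Or.inl (c.Su_subset_E hz)
  · by_cases h : z = -c.r₂
    · exact Or.inr (Or.inr h)
    · exact Or.inl (c.mem_E_of_mem_L₂ hz h)

/-- The cross-cut lies in the closure of `E`. [folklore] -/
theorem P_subset_closure : c.P ⊆ closure c.E := by
  intro z hz
  rcases c.P_subset_union hz with h | h | h
  · exact subset_closure h
  · rw [h]; exact frontier_subset_closure c.r₁_mem_frontier
  · rw [h]; exact frontier_subset_closure c.neg_r₂_mem_frontier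

/-- `Vu ⊆ E ∖ P`. [folklore] -/
theorem Vu_subset : c.Vu ⊆ c.E \ c.P := c.Vu_union_Vl' ▸ subset_union_left
/-- `Vl ⊆ E ∖ P`. [folklore] -/
theorem Vl_subset : c.Vl ⊆ c.E \ c.P := c.Vu_union_Vl' ▸ subset_union_right
/-- `Vu ⊆ E`. [folklore] -/
theorem Vu_subset_E : c.Vu ⊆ c.E := c.Vu_subset.trans (fun _ h => h.1)
/-- `Vl ⊆ E`. [folklore] -/
theorem Vl_subset_E : c.Vl ⊆ c.E := c.Vl_subset.trans (fun _ h => h.1)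

/-- `Vu` is bounded. [folklore] -/
theorem isBounded_Vu : IsBounded c.Vu := c.isBounded_E.subset c.Vu_subset_E
/-- `Vl` is bounded. [folklore] -/
theorem isBounded_Vl : IsBounded c.Vl := c.isBounded_E.subset c.Vl_subset_E

/-- The junctions of the upper loop `[r₁ → 1] · (upper semicircle) · [-1 → -r₂] · κu`. [folklore] -/
theorem quadJunction_up : QuadJunction (rayPos c.r₁) semiUp (rayNeg c.r₂) c.κu :=
  ⟨by simp, by simp, by rw [rayNeg_one, c.κu_zero], by rw [c.κu_one, rayPos_zero]⟩

/-- The junctions of the lower-big loop (same cut, the arc `κl`). [folklore] -/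
theorem quadJunction_lowBig : QuadJunction (rayPos c.r₁) semiUp (rayNeg c.r₂) c.κl :=
  ⟨by simp, by simp, by rw [rayNeg_one, c.κl_zero], by rw [c.κl_one, rayPos_zero]⟩

/-- The junctions of the lower loop `[r₁ → 1] · (lower semicircle) · [-1 → -r₂] · κl`. [folklore] -/
theorem quadJunction_low : QuadJunction (rayPos c.r₁) semiDown (rayNeg c.r₂) c.κl :=
  ⟨by simp, by simp, by rw [rayNeg_one, c.κl_zero], by rw [c.κl_one, rayPos_zero]⟩

/-- Injectivity of a loop `[r₁ → 1] · S · [-1 → -r₂] · κ` with `S` a unit semicircle and `κ` a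
frontier arc of `E`. [folklore] -/
theorem injOn_quadLoop_of {S κ : ℝ → ℂ} (hj : QuadJunction (rayPos c.r₁) S (rayNeg c.r₂) κ)
    (hS : InjOn S (Icc 0 1)) (hκ : InjOn κ (Icc 0 1)) (hSs : S '' Icc 0 1 ⊆ sphere 0 1)
    (hκf : κ '' Icc 0 1 ⊆ frontier c.E) :
    InjOn (quadLoop (rayPos c.r₁) S (rayNeg c.r₂) κ) (Ico 0 1) := by
  have hS0 : S 0 = 1 := by rw [← hj.j₀, rayPos_one]
  have hκ0 : κ 0 = -c.r₂ := by rw [← hj.j₂, rayNeg_one]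
  refine injOn_quadLoop hj (injOn_rayPos c.one_lt_r₁) hS (injOn_rayNeg c.one_lt_r₂) hκ ?_ ?_ ?_ ?_
    ?_ ?_
  · rw [hS0]
    exact fun z hz => image_rayPos_inter_sphere c.one_lt_r₁ ⟨hz.1, hSs hz.2⟩
  · rw [rayNeg_zero]
    exact fun z hz => image_rayNeg_inter_sphere c.one_lt_r₂ ⟨hz.2, hSs hz.1⟩
  · rw [hκ0]
    exact fun z hz => c.L₂_inter_frontier ⟨hz.1, hκf hz.2⟩
  · rw [rayPos_zero]
    exact fun z hz => c.L₁_inter_frontier ⟨hz.2, hκf hz.1⟩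
  · exact disjoint_image_rayPos_image_rayNeg c.one_lt_r₁ c.one_lt_r₂
  · exact Set.disjoint_left.2 fun z hz hz' =>
      c.not_mem_E_of_mem_frontier (hκf hz') (c.sphere_subset_E (hSs hz))

/-! #### The upper face and the lower-big domain as Jordan domains -/

/-- **The upper face** `Vu` as a Jordan domain, with boundary loop
`[r₁ → 1] · (upper unit semicircle) · [-1 → -r₂] · κu` at quarter parameters. [folklore] -/
def upperFace : JordanDomain where
  carrier := c.Vu
  boundary := quadLoop (rayPos c.r₁) semiUp (rayNeg c.r₂) c.κu
  isOpen := c.isOpen_Vu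
  isBounded := c.isBounded_Vu
  isConnected := c.isConnected_Vu
  continuous_boundary := continuous_quadLoop c.quadJunction_up continuous_rayPos continuous_semiUp
    continuous_rayNeg c.continuous_κu
  periodic_boundary := periodic_quadLoop
  injOn_boundary := c.injOn_quadLoop_of c.quadJunction_up injOn_semiUp c.injOn_κu
    image_semiUp_subset_sphere c.Ku_subset_frontier
  range_boundary := by rw [range_quadLoop c.quadJunction_up, c.frontier_Vu]

/-- **The lower-big domain** `Vl` (lower face together with the unit disc) as a Jordan domain,
boundary loop `[r₁ → 1] · (upper unit semicircle) · [-1 → -r₂] · κl`. [folklore] -/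
def lowerBig : JordanDomain where
  carrier := c.Vl
  boundary := quadLoop (rayPos c.r₁) semiUp (rayNeg c.r₂) c.κl
  isOpen := c.isOpen_Vl
  isBounded := c.isBounded_Vl
  isConnected := c.isConnected_Vl
  continuous_boundary := continuous_quadLoop c.quadJunction_lowBig continuous_rayPos
    continuous_semiUp continuous_rayNeg c.continuous_κl
  periodic_boundary := periodic_quadLoop
  injOn_boundary := c.injOn_quadLoop_of c.quadJunction_lowBig injOn_semiUp c.injOn_κl
    image_semiUp_subset_sphere c.Kl_subset_frontier
  range_boundary := by rw [range_quadLoop c.quadJunction_lowBig, c.frontier_Vl]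

/-- The carrier of the upper face is `Vu`. [folklore] -/
@[simp] theorem upperFace_carrier : c.upperFace.carrier = c.Vu := rfl
/-- The carrier of the lower-big domain is `Vl`. [folklore] -/
@[simp] theorem lowerBig_carrier : c.lowerBig.carrier = c.Vl := rfl
/-- The boundary loop of the upper face. [folklore] -/
theorem upperFace_boundary : c.upperFace.boundary = quadLoop (rayPos c.r₁) semiUp (rayNeg c.r₂) c.κu := rfl
/-- The boundary loop of the lower-big domain. [folklore] -/
theorem lowerBig_boundary : c.lowerBig.boundary = quadLoop (rayPos c.r₁) semiUp (rayNeg c.r₂) c.κl := rfl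

/-! #### The lower semicircle is a cross-cut of the lower-big domain -/

/-- The open lower semicircle lies in `E ∖ P`. [folklore] -/
theorem image_semiDown_Ioo_subset : semiDown '' Ioo 0 1 ⊆ c.E \ c.P := by
  intro z hz
  have hzim : z.im < 0 := im_neg_of_mem_image_semiDown_Ioo hz
  have hzS : z ∈ sphere (0 : ℂ) 1 := image_semiDown_subset_sphere (image_mono Ioo_subset_Icc_self hz)
  refine ⟨c.sphere_subset_E hzS, ?_⟩
  rintro ((h | h) | h)
  · obtain ⟨x, -, rfl⟩ := (mem_image_rayPos_iff c.one_lt_r₁).1 h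
    simp at hzim
  · linarith [im_nonneg_of_mem_image_semiUp h]
  · obtain ⟨x, -, rfl⟩ := (mem_image_rayNeg_iff c.one_lt_r₂).1 h
    simp at hzim

/-- **The open lower semicircle lies in the lower-big component `Vl`** (it is connected, lies
in `E ∖ P = Vu ∪ Vl`, and accumulates at the open unit disc `⊆ Vl`). [folklore] -/
theorem image_semiDown_Ioo_subset_Vl : semiDown '' Ioo 0 1 ⊆ c.Vl := by
  have hconn : IsPreconnected (semiDown '' Ioo 0 1) :=
    (isPreconnected_Ioo).image _ continuous_semiDown.continuousOn
  have hsub : semiDown '' Ioo 0 1 ⊆ c.Vu ∪ c.Vl := by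
    rw [c.Vu_union_Vl']; exact c.image_semiDown_Ioo_subset
  rcases hconn.subset_or_subset c.isOpen_Vu c.isOpen_Vl c.disjoint_Vu_Vl hsub with h | h
  · exfalso
    -- the point `-i` of the open lower semicircle would lie in the open set `Vu`, but it is a
    -- limit of points `-ti`, `t < 1`, of the unit disc `⊆ Vl`
    have hi : semiDown (1 / 2) ∈ c.Vu := h ⟨1 / 2, by norm_num, rfl⟩
    have hval : semiDown (1 / 2) = -Complex.I := by
      rw [semiDown, show -((1 : ℝ) / 2 / 2) = 3 / 4 - 1 by norm_num,
        (disc 1 one_pos).periodic_boundary.sub_eq, disc_boundary_three_quarters]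
      simp
    rw [hval] at hi
    obtain ⟨ε, hε, hball⟩ := Metric.isOpen_iff.1 c.isOpen_Vu _ hi
    set t : ℝ := 1 - min (ε / 2) (1 / 2) with ht
    have ht1 : t < 1 := by rw [ht]; linarith [lt_min (half_pos hε) one_half_pos]
    have ht0 : 0 < t := by rw [ht]; linarith [min_le_right (ε / 2) (1 / 2)]
    have hmem_ball : (-(t : ℂ) * Complex.I) ∈ ball (0 : ℂ) 1 := by
      rw [mem_ball_zero_iff, norm_mul, norm_neg, Complex.norm_real, Complex.norm_I, mul_one,
        Real.norm_eq_abs, abs_of_pos ht0]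
      exact ht1
    have hmem_eps : (-(t : ℂ) * Complex.I) ∈ ball (-Complex.I) ε := by
      rw [mem_ball, dist_eq_norm, show -(t : ℂ) * Complex.I - -Complex.I = ((1 - t : ℝ) : ℂ) * Complex.I by
        push_cast; ring, norm_mul, Complex.norm_real, Complex.norm_I, mul_one, Real.norm_eq_abs,
        abs_of_nonneg (by linarith)]
      rw [ht]; linarith [min_le_left (ε / 2) (1 / 2)]
    exact Set.disjoint_left.1 c.disjoint_Vu_Vl (hball hmem_eps) (c.ball_subset_Vl hmem_ball)
  · exact h

/-- The lower semicircle is a cross-cut of the lower-big domain, from `boundary ¼ = 1` to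
`boundary ½ = -1`. [folklore] -/
theorem isCrosscut_Sd : c.lowerBig.IsCrosscut Sd (c.lowerBig.boundary (1 / 4))
    (c.lowerBig.boundary (1 / 2)) := by
  rw [lowerBig_boundary, quadLoop_quarter c.quadJunction_lowBig, quadLoop_half c.quadJunction_lowBig,
    semiUp_zero, rayNeg_zero]
  refine ⟨isSimpleArc_semiDown, ?_, ?_, by norm_num, ?_⟩
  · rw [← c.lowerBig.range_boundary, lowerBig_boundary, range_quadLoop c.quadJunction_lowBig]
    exact Or.inl (Or.inl (Or.inl ⟨1, ⟨zero_le_one, le_rfl⟩, rayPos_one⟩))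
  · rw [← c.lowerBig.range_boundary, lowerBig_boundary, range_quadLoop c.quadJunction_lowBig]
    exact Or.inl (Or.inl (Or.inr ⟨1, ⟨zero_le_one, le_rfl⟩, semiUp_one⟩))
  · exact fun z hz => c.image_semiDown_Ioo_subset_Vl (image_semiDown_diff hz)

/-! #### The lower face, from Newman's theorem in the lower-big domain -/

/-- Periodicity: the image of `[1, 5/4]` under a `1`-periodic loop is that of `[0, ¼]`.
[folklore] -/
theorem image_Icc_one_five_quarters {γ : ℝ → ℂ} (hp : Function.Periodic γ 1) :
    γ '' Icc 1 (5 / 4) = γ '' Icc 0 (1 / 4) := by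
  ext z; constructor
  · rintro ⟨t, ht, rfl⟩
    exact ⟨t - 1, ⟨by linarith [ht.1], by linarith [ht.2]⟩, hp.sub_eq t⟩
  · rintro ⟨t, ht, rfl⟩
    exact ⟨t + 1, ⟨by linarith [ht.1], by linarith [ht.2]⟩, hp t⟩

/-- **Newman's theorem in the lower-big domain**: the lower semicircle splits `Vl` into the
open unit disc and a domain `W` with `frontier W = [1, r₁] ∪ (lower semicircle) ∪ [-r₂, -1] ∪ κl`.
[cite: Newman1939, Ch. V §11, Thms. 11·7 and 11·8, pp. 94–95] -/
theorem exists_lowerFace_carrier : ∃ W : Set ℂ, IsOpen W ∧ IsConnected W ∧ Disjoint (ball 0 1) W ∧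
    ball 0 1 ∪ W = c.Vl \ Sd ∧ frontier W = (c.L₁ ∪ Sd ∪ c.L₂) ∪ c.Kl := by
  obtain ⟨U₁, U₂, hU₁o, hU₂o, hU₁c, hU₂c, hdisj, hunion, hfr₁, hfr₂⟩ :=
    Newman1939_crosscut_holds c.lowerBig Sd (1 / 4) (1 / 2) (by norm_num) (by norm_num) c.isCrosscut_Sd
  -- the boundary arcs
  have hA₁ : c.lowerBig.boundary '' Icc (1 / 4) (1 / 2) = Su := by
    rw [lowerBig_boundary, image_quadLoop_second c.quadJunction_lowBig]; rfl
  have hA₂ : c.lowerBig.boundary '' Icc (1 / 2) (1 / 4 + 1) = c.L₂ ∪ c.Kl ∪ c.L₁ := by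
    rw [show (1 / 4 + 1 : ℝ) = 5 / 4 by norm_num, ← Icc_union_Icc_eq_Icc (show (1 / 2 : ℝ) ≤ 3 / 4 by
      norm_num) (show (3 / 4 : ℝ) ≤ 5 / 4 by norm_num), ← Icc_union_Icc_eq_Icc (show (3 / 4 : ℝ) ≤ 1
      by norm_num) (show (1 : ℝ) ≤ 5 / 4 by norm_num), image_union, image_union, lowerBig_boundary,
      image_quadLoop_third c.quadJunction_lowBig, image_quadLoop_fourth c.quadJunction_lowBig,
      image_Icc_one_five_quarters periodic_quadLoop, image_quadLoop_first c.quadJunction_lowBig,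
      ← union_assoc]
    rfl
  rw [hA₁] at hfr₁
  rw [hA₂] at hfr₂
  -- `U₁` is the unit disc
  have hfrU₁ : frontier U₁ = sphere 0 1 := by
    rw [hfr₁, Sd, Su, union_comm, image_semiUp_union_image_semiDown]
  have hU₁b : IsBounded U₁ := c.isBounded_Vl.subset ((subset_union_left.trans hunion.le).trans (fun _ h => h.1))
  have hU₁ : U₁ = ball 0 1 := by
    have := carrier_eq_of_frontier_eq' (disc 1 one_pos) hU₁o hU₁b hU₁c
      (by rw [hfrU₁, frontier_disc_carrier])
    simpa using this
  subst hU₁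
  refine ⟨U₂, hU₂o, hU₂c, hdisj, hunion, ?_⟩
  rw [hfr₂]
  ext z; simp only [mem_union]; tauto

/-- The carrier of the lower face (chosen from `exists_lowerFace_carrier`). [folklore] -/
def Wl : Set ℂ := c.exists_lowerFace_carrier.choose

/-- The lower face is open. [folklore] -/
theorem isOpen_Wl : IsOpen c.Wl := c.exists_lowerFace_carrier.choose_spec.1
/-- The lower face is connected. [folklore] -/
theorem isConnected_Wl : IsConnected c.Wl := c.exists_lowerFace_carrier.choose_spec.2.1
/-- The lower face misses the unit disc. [folklore] -/
theorem disjoint_ball_Wl : Disjoint (ball 0 1) c.Wl := c.exists_lowerFace_carrier.choose_spec.2.2.1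
/-- The unit disc and the lower face make up `Vl` minus the lower semicircle. [folklore] -/
theorem ball_union_Wl : ball 0 1 ∪ c.Wl = c.Vl \ Sd := c.exists_lowerFace_carrier.choose_spec.2.2.2.1
/-- The frontier of the lower face is `[1, r₁] ∪ (lower semicircle) ∪ [-r₂, -1] ∪ κl`. [folklore] -/
theorem frontier_Wl : frontier c.Wl = (c.L₁ ∪ Sd ∪ c.L₂) ∪ c.Kl :=
  c.exists_lowerFace_carrier.choose_spec.2.2.2.2

/-- The lower face lies in `Vl`. [folklore] -/
theorem Wl_subset_Vl : c.Wl ⊆ c.Vl := (subset_union_right.trans c.ball_union_Wl.le).trans (fun _ h => h.1)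
/-- The lower face lies in `E`. [folklore] -/
theorem Wl_subset_E : c.Wl ⊆ c.E := c.Wl_subset_Vl.trans c.Vl_subset_E

/-- **The lower face** as a Jordan domain, boundary loop
`[r₁ → 1] · (lower unit semicircle) · [-1 → -r₂] · κl` at quarter parameters. [folklore] -/
def lowerFace : JordanDomain where
  carrier := c.Wl
  boundary := quadLoop (rayPos c.r₁) semiDown (rayNeg c.r₂) c.κl
  isOpen := c.isOpen_Wl
  isBounded := c.isBounded_E.subset c.Wl_subset_E
  isConnected := c.isConnected_Wl
  continuous_boundary := continuous_quadLoop c.quadJunction_low continuous_rayPos continuous_semiDown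
    continuous_rayNeg c.continuous_κl
  periodic_boundary := periodic_quadLoop
  injOn_boundary := c.injOn_quadLoop_of c.quadJunction_low injOn_semiDown c.injOn_κl
    image_semiDown_subset_sphere c.Kl_subset_frontier
  range_boundary := by rw [range_quadLoop c.quadJunction_low, c.frontier_Wl]; rfl

/-- The carrier of the lower face is `Wl`. [folklore] -/
@[simp] theorem lowerFace_carrier : c.lowerFace.carrier = c.Wl := rfl
/-- The boundary loop of the lower face. [folklore] -/
theorem lowerFace_boundary : c.lowerFace.boundary = quadLoop (rayPos c.r₁) semiDown (rayNeg c.r₂) c.κl := rfl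

/-! #### Partition of the cut annulus -/

/-- The frontier of the upper face. [folklore] -/
theorem frontier_upperFace : frontier c.Vu = c.L₁ ∪ Su ∪ c.L₂ ∪ c.Ku := c.frontier_Vu
/-- The frontier of the lower face. [folklore] -/
theorem frontier_lowerFace : frontier c.Wl = c.L₁ ∪ Sd ∪ c.L₂ ∪ c.Kl := c.frontier_Wl

/-- The two faces are disjoint. [folklore] -/
theorem disjoint_Vu_Wl : Disjoint c.Vu c.Wl := c.disjoint_Vu_Vl.mono_right c.Wl_subset_Vl

/-- The upper face misses the unit disc. [folklore] -/
theorem disjoint_Vu_ball : Disjoint c.Vu (ball 0 1) := c.disjoint_Vu_Vl.mono_right c.ball_subset_Vl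

/-- The upper face misses the closed unit disc. [folklore] -/
theorem disjoint_Vu_closedBall : Disjoint c.Vu (closedBall 0 1) := by
  rw [← closure_ball (0 : ℂ) one_ne_zero]
  exact c.disjoint_Vu_ball.closure_right c.isOpen_Vu

/-- The lower face misses the closed unit disc. [folklore] -/
theorem disjoint_Wl_closedBall : Disjoint c.Wl (closedBall 0 1) := by
  rw [← closure_ball (0 : ℂ) one_ne_zero]
  exact c.disjoint_ball_Wl.symm.closure_right c.isOpen_Wl

/-- **`E` minus the closed unit disc and the two rays is the disjoint union of the two faces.**
[folklore] -/
theorem diff_eq_Vu_union_Wl : c.E \ (closedBall 0 1 ∪ c.L₁ ∪ c.L₂) = c.Vu ∪ c.Wl := by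
  apply Subset.antisymm
  · rintro z ⟨hzE, hz⟩
    simp only [mem_union, not_or] at hz
    obtain ⟨⟨hzB, hzL₁⟩, hzL₂⟩ := hz
    have hzP : z ∉ c.P := by
      rintro ((h | h) | h)
      · exact hzL₁ h
      · exact hzB (sphere_subset_closedBall (image_semiUp_subset_sphere h))
      · exact hzL₂ h
    have hz' : z ∈ c.Vu ∪ c.Vl := by rw [c.Vu_union_Vl']; exact ⟨hzE, hzP⟩
    rcases hz' with h | h
    · exact Or.inl h
    · have hzS : z ∉ Sd := fun h' => hzB (sphere_subset_closedBall (image_semiDown_subset_sphere h'))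
      have : z ∈ ball 0 1 ∪ c.Wl := by rw [c.ball_union_Wl]; exact ⟨h, hzS⟩
      rcases this with h' | h'
      · exact absurd (ball_subset_closedBall h') hzB
      · exact Or.inr h'
  · rintro z (hz | hz)
    · refine ⟨c.Vu_subset_E hz, ?_⟩
      rintro ((h | h) | h)
      · exact Set.disjoint_left.1 c.disjoint_Vu_closedBall hz h
      · exact (c.Vu_subset hz).2 (Or.inl (Or.inl h))
      · exact (c.Vu_subset hz).2 (Or.inr h)
    · refine ⟨c.Wl_subset_E hz, ?_⟩
      rintro ((h | h) | h)
      · exact Set.disjoint_left.1 c.disjoint_Wl_closedBall hz h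
      · exact (c.Vl_subset (c.Wl_subset_Vl hz)).2 (Or.inl (Or.inl h))
      · exact (c.Vl_subset (c.Wl_subset_Vl hz)).2 (Or.inr h)

/-- `E` is covered by the closed unit disc and the closures of the two faces. [folklore] -/
theorem E_subset : c.E ⊆ closedBall 0 1 ∪ closure c.Vu ∪ closure c.Wl := by
  intro z hz
  by_cases h : z ∈ closedBall (0 : ℂ) 1 ∪ c.L₁ ∪ c.L₂
  · rcases h with (h | h) | h
    · exact Or.inl (Or.inl h)
    · refine Or.inl (Or.inr ?_)
      rw [closure_eq_self_union_frontier, c.frontier_upperFace]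
      exact Or.inr (Or.inl (Or.inl (Or.inl h)))
    · refine Or.inl (Or.inr ?_)
      rw [closure_eq_self_union_frontier, c.frontier_upperFace]
      exact Or.inr (Or.inl (Or.inr h))
  · have : z ∈ c.Vu ∪ c.Wl := by rw [← c.diff_eq_Vu_union_Wl]; exact ⟨hz, h⟩
    rcases this with h' | h'
    · exact Or.inl (Or.inr (subset_closure h'))
    · exact Or.inr (subset_closure h')

/-- The whole plane is covered by the closed unit disc, the closures of the two faces and the
complement of `E`. [folklore] -/
theorem union_eq_univ : closedBall 0 1 ∪ closure c.Vu ∪ closure c.Wl ∪ c.Eᶜ = univ := by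
  refine eq_univ_of_forall fun z => ?_
  by_cases hz : z ∈ c.E
  · exact Or.inl (c.E_subset hz)
  · exact Or.inr hz

/-! #### Pairwise intersections of the four closed pieces -/

/-- The closure of the upper face. [folklore] -/
theorem closure_Vu_eq : closure c.Vu = c.Vu ∪ (c.L₁ ∪ Su ∪ c.L₂ ∪ c.Ku) := by
  rw [closure_eq_self_union_frontier, c.frontier_upperFace]

/-- The closure of the lower face. [folklore] -/
theorem closure_Wl_eq : closure c.Wl = c.Wl ∪ (c.L₁ ∪ Sd ∪ c.L₂ ∪ c.Kl) := by
  rw [closure_eq_self_union_frontier, c.frontier_lowerFace]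

/-- `closure Vu ∩ closed unit disc = upper semicircle`. [folklore] -/
theorem closure_Vu_inter_closedBall : closure c.Vu ∩ closedBall 0 1 = Su := by
  apply Subset.antisymm
  · rintro z ⟨hz, hzB⟩
    rw [c.closure_Vu_eq] at hz
    have hzB' : ‖z‖ ≤ 1 := mem_closedBall_zero_iff.1 hzB
    rcases hz with hz | ((hz | hz) | hz) | hz
    · exact absurd hzB (Set.disjoint_left.1 c.disjoint_Vu_closedBall hz)
    · rw [eq_one_of_mem_image_rayPos c.one_lt_r₁ hz hzB']; exact ⟨0, by norm_num, semiUp_zero⟩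
    · exact hz
    · rw [eq_neg_one_of_mem_image_rayNeg c.one_lt_r₂ hz hzB']; exact ⟨1, by norm_num, semiUp_one⟩
    · exact absurd (c.closedBall_subset hzB) (c.not_mem_E_of_mem_frontier (c.Ku_subset_frontier hz))
  · intro z hz
    refine ⟨?_, sphere_subset_closedBall (image_semiUp_subset_sphere hz)⟩
    rw [c.closure_Vu_eq]; exact Or.inr (Or.inl (Or.inl (Or.inr hz)))

/-- `closure Wl ∩ closed unit disc = lower semicircle`. [folklore] -/
theorem closure_Wl_inter_closedBall : closure c.Wl ∩ closedBall 0 1 = Sd := by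
  apply Subset.antisymm
  · rintro z ⟨hz, hzB⟩
    rw [c.closure_Wl_eq] at hz
    have hzB' : ‖z‖ ≤ 1 := mem_closedBall_zero_iff.1 hzB
    rcases hz with hz | ((hz | hz) | hz) | hz
    · exact absurd hzB (Set.disjoint_left.1 c.disjoint_Wl_closedBall hz)
    · rw [eq_one_of_mem_image_rayPos c.one_lt_r₁ hz hzB']; exact ⟨0, by norm_num, semiDown_zero⟩
    · exact hz
    · rw [eq_neg_one_of_mem_image_rayNeg c.one_lt_r₂ hz hzB']; exact ⟨1, by norm_num, semiDown_one⟩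
    · exact absurd (c.closedBall_subset hzB) (c.not_mem_E_of_mem_frontier (c.Kl_subset_frontier hz))
  · intro z hz
    refine ⟨?_, sphere_subset_closedBall (image_semiDown_subset_sphere hz)⟩
    rw [c.closure_Wl_eq]; exact Or.inr (Or.inl (Or.inl (Or.inr hz)))

/-- `closure Vu ∩ closure Wl = [1, r₁] ∪ [-r₂, -1]`. [folklore] -/
theorem closure_Vu_inter_closure_Wl : closure c.Vu ∩ closure c.Wl = c.L₁ ∪ c.L₂ := by
  apply Subset.antisymm
  · rintro z ⟨hzu, hzl⟩
    -- neither point lies in the open faces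
    have hzu' : z ∉ c.Vu := fun h =>
      (Set.disjoint_left.1 (c.disjoint_Vu_Wl.closure_right c.isOpen_Vu) h) hzl
    have hzl' : z ∉ c.Wl := fun h =>
      (Set.disjoint_left.1 (c.disjoint_Vu_Wl.symm.closure_right c.isOpen_Wl) h) hzu
    rw [c.closure_Vu_eq] at hzu
    rw [c.closure_Wl_eq] at hzl
    replace hzu := hzu.resolve_left hzu'
    replace hzl := hzl.resolve_left hzl'
    rcases hzu with ((hzu | hzu) | hzu) | hzu
    · exact Or.inl hzu
    · rcases hzl with ((hzl | hzl) | hzl) | hzl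
      · exact Or.inl hzl
      · rcases image_semiUp_inter_image_semiDown ⟨hzu, hzl⟩ with h | h
        · rw [h]; exact Or.inl ⟨1, ⟨zero_le_one, le_rfl⟩, rayPos_one⟩
        · rw [h]; exact Or.inr ⟨0, ⟨le_rfl, zero_le_one⟩, rayNeg_zero⟩
      · exact Or.inr hzl
      · exact absurd (c.Su_subset_E hzu) (c.not_mem_E_of_mem_frontier (c.Kl_subset_frontier hzl))
    · exact Or.inr hzu
    · rcases hzl with ((hzl | hzl) | hzl) | hzl
      · exact Or.inl hzl
      · exact absurd (c.Sd_subset_E hzl) (c.not_mem_E_of_mem_frontier (c.Ku_subset_frontier hzu))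
      · exact Or.inr hzl
      · rcases c.image_κu_inter_image_κl ⟨hzu, hzl⟩ with h | h
        · rw [h]; exact Or.inl ⟨0, ⟨le_rfl, zero_le_one⟩, rayPos_zero⟩
        · rw [h]; exact Or.inr ⟨1, ⟨zero_le_one, le_rfl⟩, rayNeg_one⟩
  · rintro z (hz | hz)
    · exact ⟨by rw [c.closure_Vu_eq]; exact Or.inr (Or.inl (Or.inl (Or.inl hz))),
        by rw [c.closure_Wl_eq]; exact Or.inr (Or.inl (Or.inl (Or.inl hz)))⟩
    · exact ⟨by rw [c.closure_Vu_eq]; exact Or.inr (Or.inl (Or.inr hz)),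
        by rw [c.closure_Wl_eq]; exact Or.inr (Or.inl (Or.inr hz))⟩

/-- `closure Vu ∩ Eᶜ = κu`. [folklore] -/
theorem closure_Vu_inter_compl : closure c.Vu ∩ c.Eᶜ = c.Ku := by
  apply Subset.antisymm
  · rintro z ⟨hz, hzE⟩
    rw [c.closure_Vu_eq] at hz
    rcases hz with hz | ((hz | hz) | hz) | hz
    · exact absurd (c.Vu_subset_E hz) hzE
    · have h := c.P_subset_union (Or.inl (Or.inl hz))
      rcases h with h | h | h
      · exact absurd h hzE
      · rw [h]; exact ⟨1, ⟨zero_le_one, le_rfl⟩, c.κu_one⟩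
      · rw [h]; exact ⟨0, ⟨le_rfl, zero_le_one⟩, c.κu_zero⟩
    · exact absurd (c.Su_subset_E hz) hzE
    · have h := c.P_subset_union (Or.inr hz)
      rcases h with h | h | h
      · exact absurd h hzE
      · rw [h]; exact ⟨1, ⟨zero_le_one, le_rfl⟩, c.κu_one⟩
      · rw [h]; exact ⟨0, ⟨le_rfl, zero_le_one⟩, c.κu_zero⟩
    · exact hz
  · intro z hz
    exact ⟨by rw [c.closure_Vu_eq]; exact Or.inr (Or.inr hz),
      c.not_mem_E_of_mem_frontier (c.Ku_subset_frontier hz)⟩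

/-- `closure Wl ∩ Eᶜ = κl`. [folklore] -/
theorem closure_Wl_inter_compl : closure c.Wl ∩ c.Eᶜ = c.Kl := by
  apply Subset.antisymm
  · rintro z ⟨hz, hzE⟩
    rw [c.closure_Wl_eq] at hz
    rcases hz with hz | ((hz | hz) | hz) | hz
    · exact absurd (c.Wl_subset_E hz) hzE
    · have h := c.P_subset_union (Or.inl (Or.inl hz))
      rcases h with h | h | h
      · exact absurd h hzE
      · rw [h]; exact ⟨1, ⟨zero_le_one, le_rfl⟩, c.κl_one⟩
      · rw [h]; exact ⟨0, ⟨le_rfl, zero_le_one⟩, c.κl_zero⟩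
    · exact absurd (c.Sd_subset_E hz) hzE
    · have h := c.P_subset_union (Or.inr hz)
      rcases h with h | h | h
      · exact absurd h hzE
      · rw [h]; exact ⟨1, ⟨zero_le_one, le_rfl⟩, c.κl_one⟩
      · rw [h]; exact ⟨0, ⟨le_rfl, zero_le_one⟩, c.κl_zero⟩
    · exact hz
  · intro z hz
    exact ⟨by rw [c.closure_Wl_eq]; exact Or.inr (Or.inr hz),
      c.not_mem_E_of_mem_frontier (c.Kl_subset_frontier hz)⟩

/-- The closed unit disc misses `Eᶜ`. [folklore] -/
theorem closedBall_inter_compl : closedBall (0 : ℂ) 1 ∩ c.Eᶜ = ∅ :=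
  eq_empty_of_forall_notMem fun _ hz => hz.2 (c.closedBall_subset hz.1)

/-- The closure of `E` is the closed disc, the closures of the faces, and the frontier.
[folklore] -/
theorem compl_E_eq : c.Eᶜ = (closure c.E)ᶜ ∪ frontier c.E := by
  rw [closure_eq_self_union_frontier, compl_union]
  ext z
  constructor
  · intro hz
    by_cases h : z ∈ frontier c.E
    · exact Or.inr h
    · exact Or.inl ⟨hz, h⟩
  · rintro (⟨hz, -⟩ | hz)
    · exact hz
    · exact c.not_mem_E_of_mem_frontier hz

/-! #### The outer boundary loop `κu · κl⁻¹` and `E` as a Jordan domain -/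

/-- The frontier of `E` as one loop: `κu` from `-r₂` to `r₁` on `[0, ½]`, then `κl` backwards
from `r₁` to `-r₂` on `[½, 1]`. [folklore] -/
def outerLoop : ℝ → ℂ := concatPath c.κu (fun u => c.κl (1 - u)) ∘ Int.fract

/-- The un-periodised outer loop closes up. [folklore] -/
theorem outer_concat_zero_eq_one :
    concatPath c.κu (fun u => c.κl (1 - u)) 0 = concatPath c.κu (fun u => c.κl (1 - u)) 1 := by
  rw [concatPath_zero, concatPath_one, c.κu_zero]; simp [c.κl_zero]

/-- The junction of the outer loop: `κu 1 = r₁ = κl 1`. [folklore] -/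
theorem outer_junction : c.κu 1 = (fun u => c.κl (1 - u)) 0 := by simp [c.κu_one, c.κl_one]

/-- The outer loop is continuous. [folklore] -/
theorem continuous_outerLoop : Continuous c.outerLoop :=
  (continuous_concatPath c.continuous_κu (c.continuous_κl.comp (continuous_const.sub continuous_id))
    c.outer_junction).continuousOn.comp_fract'' c.outer_concat_zero_eq_one

/-- The outer loop is `1`-periodic. [folklore] -/
theorem periodic_outerLoop : Function.Periodic c.outerLoop 1 := periodic_comp_fract

/-- The trace of the reversed arc `κl` is that of `κl`. [folklore] -/
theorem image_κl_rev : (fun u => c.κl (1 - u)) '' Icc 0 1 = c.Kl := by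
  ext z; constructor
  · rintro ⟨u, hu, rfl⟩; exact ⟨1 - u, ⟨by linarith [hu.2], by linarith [hu.1]⟩, rfl⟩
  · rintro ⟨u, hu, rfl⟩; exact ⟨1 - u, ⟨by linarith [hu.2], by linarith [hu.1]⟩, by simp⟩

/-- The outer loop is injective on a period. [folklore] -/
theorem injOn_outerLoop : InjOn c.outerLoop (Ico 0 1) := by
  refine injOn_comp_fract (injOn_concatPath_Ico c.injOn_κu ?_ c.outer_junction (by simp [c.κl_zero, c.κu_zero]) ?_)
  · intro u hu v hv h
    have := c.injOn_κl ⟨by linarith [hu.2], by linarith [hu.1]⟩ ⟨by linarith [hv.2], by linarith [hv.1]⟩ h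
    linarith
  · rw [image_κl_rev, c.κu_one, c.κu_zero]
    exact c.image_κu_inter_image_κl

/-- The range of the outer loop is the frontier of `E`. [folklore] -/
theorem range_outerLoop : range c.outerLoop = frontier c.E := by
  rw [outerLoop, range_comp_fract c.outer_concat_zero_eq_one, image_concatPath_Icc_zero_one c.outer_junction,
    image_κl_rev, c.frontier_E']; rfl

/-- On `[0, ½]` the outer loop runs through `κu`: `outerLoop (v/2) = κu v`. [folklore] -/
theorem outerLoop_half_mul {v : ℝ} (hv : v ∈ Icc (0 : ℝ) 1) : c.outerLoop (v / 2) = c.κu v := by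
  rw [outerLoop, comp_fract_apply_of_mem_Icc c.outer_concat_zero_eq_one ⟨by linarith [hv.1], by linarith [hv.2]⟩,
    concatPath_of_le_half (by linarith [hv.2])]
  ring_nf

/-- On `[½, 1]` the outer loop runs backwards through `κl`: `outerLoop (1 - v/2) = κl v`. [folklore] -/
theorem outerLoop_one_sub_half_mul {v : ℝ} (hv : v ∈ Icc (0 : ℝ) 1) : c.outerLoop (1 - v / 2) = c.κl v := by
  rw [outerLoop, comp_fract_apply_of_mem_Icc c.outer_concat_zero_eq_one ⟨by linarith [hv.2], by linarith [hv.1]⟩,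
    concatPath_of_half_le c.outer_junction (by linarith [hv.2])]
  show c.κl (1 - (2 * (1 - v / 2) - 1)) = c.κl v
  ring_nf

/-- **`E` as a Jordan domain**, with the outer loop as boundary parametrisation. [folklore] -/
def outerDomain : JordanDomain where
  carrier := c.E
  boundary := c.outerLoop
  isOpen := c.isOpen_E
  isBounded := c.isBounded_E
  isConnected := c.isConnected_E
  continuous_boundary := c.continuous_outerLoop
  periodic_boundary := c.periodic_outerLoop
  injOn_boundary := c.injOn_outerLoop
  range_boundary := c.range_outerLoop

/-- The carrier of the outer domain is `E`. [folklore] -/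
@[simp] theorem outerDomain_carrier : c.outerDomain.carrier = c.E := rfl

/-- The boundary loop of the outer domain is the outer loop. [folklore] -/
theorem outerDomain_boundary : c.outerDomain.boundary = c.outerLoop := rfl

end CutData

end Literature.Topology.PlaneTopology

end
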